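import Literature.Topology.FourManifolds.BallGluingUniqueness
import Literature.Topology.FourManifolds.ClosedBallSmoothEmbeddings
import Literature.Topology.FourManifolds.InverseFunctionTheorem
import HarnessLib

/-!
# A manifold covered by two ambient discs meeting along their boundary spheres is a twisted sphere

A recognition principle for twisted spheres `Σ(φ) = 𝔻ⁿ⁺¹ ∪_φ 𝔻ⁿ⁺¹`
(`Literature.Topology.FourManifolds.IsTwistedSphere`, `TwistedSpheres.lean`; Kervaire–Milnor 1963,
§1; Milnor 1965, §9) in the form in which they arise when a manifold is cut along necks and the
pieces are capped off (R. Hamilton, *Four-manifolds with positive isotropic curvature*, Comm.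
Anal. Geom. 5 (1997), §1.1 pp. 3–4: "cutting the neck and rounding off the ends"): the two discs
are given by **smooth maps of the ambient Euclidean space** `F_A, F_B : ℝⁿ⁺¹ → Q`, injective with
injective differential on the closed unit ball `𝔻ⁿ⁺¹`, whose images of `𝔻ⁿ⁺¹` cover `Q` and meet
only in images of unit vectors, with `F_A (𝕊ⁿ) = F_B (𝕊ⁿ)` (`SmoothTwoDiscCover`). Then:

* `SmoothTwoDiscCover.transition` — the **transition diffeomorphism** `φ = F_B⁻¹ ∘ F_A : 𝕊ⁿ ≅ 𝕊ⁿ` of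
  the common boundary sphere; it is smooth by the inverse function theorem on manifolds
  (`isLocalDiffeomorphAt_of_mfderiv`, `InverseFunctionTheorem.lean`: `F_B` is a local
  diffeomorphism at the points of `𝔻ⁿ⁺¹`, its differential there being an injective endomorphism
  of `ℝⁿ⁺¹`).
* `SmoothTwoDiscCover.ballGluingData`, `SmoothTwoDiscCover.isTwistedSphere` (**main result**): `Q` is the
  twisted sphere `Σ(φ)` — the restrictions `F_A|𝔻`, `F_B|𝔻` are smooth embeddings of the manifold
  with boundary `𝔻ⁿ⁺¹` (`isSmoothEmbedding_comp_coe_closedBall_of_injective_mfderiv`,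
  `ClosedBallSmoothEmbeddings.lean`) covering `Q` and meeting exactly along `z ∼ φ z`.
* `SmoothTwoDiscCover.nonempty_diffeomorph_sphere_four`: for `n + 1 = 4`, **given Cerf's `Γ₄ = 0`**
  in twisted-sphere form (`cerf_twistedSphere_four`, `CerfGammaFour.lean`; it follows from the
  extension form `cerf_diffeomorph_sphere_three_extends_ball` by
  `cerf_twistedSphere_four_of_extends''`, `BallGluingUniqueness.lean`), such a `Q` is
  diffeomorphic to `S⁴`.

(The tree's `Literature.Topology.FourManifolds.TwoDiscCover` of `MorseReebSphereProofs.lean` is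
the purely topological analogue — two continuous injections of `𝔻ᵏ⁺¹` — yielding homeomorphisms
only; the present smooth version yields the smooth structure of a twisted sphere.)

This is the step "the capped-off ball pieces are standard spheres" in the deduction of
Hamilton's Cor. 1.2(a) from the Ricci flow with surgery as vended structurally
(`Literature.Geometry.Riemannian.chenZhu_ricciFlowWithSurgery`, `SurgicalRicciFlow.lean`), where
the caps and the surgery balls are matched only up to a diffeomorphism of `S³` (module docstring
of `SurgicalRicciFlowTopology.lean`).

## References

* M. Kervaire, J. Milnor, *Groups of homotopy spheres I*, Ann. of Math. 77 (1963), §1.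
  [KervaireMilnor1963]
* J. Milnor, *Lectures on the h-cobordism theorem*, Princeton (1965), §9. [Milnor1965]
* J. Cerf, *Sur les difféomorphismes de la sphère de dimension trois (Γ₄ = 0)*, LNM 53 (1968).
  [Cerf1968]
* J. M. Lee, *Introduction to Smooth Manifolds*, 2nd ed. (2013), Thm. 4.5. [LeeSmoothManifolds2013]
-/

open scoped Manifold ContDiff Topology
open Set Function Metric Module

noncomputable section

namespace Literature.Topology.FourManifolds

attribute [local instance] fact_finrank_euclideanSpace_succ

/-- Local notation for the model space `ℝⁿ`. -/
local notation "𝔼 " n:arg => EuclideanSpace ℝ (Fin n)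
/-- Local notation for the unit sphere `𝕊ⁿ ⊆ ℝⁿ⁺¹`. -/
local notation "𝕊 " n:arg => (Metric.sphere (0 : EuclideanSpace ℝ (Fin (n + 1))) 1)
/-- Local notation for the closed unit ball `𝔻ⁿ ⊆ ℝⁿ`. -/
local notation "𝔻 " n:arg => (Metric.closedBall (0 : EuclideanSpace ℝ (Fin n)) 1)

/-- **A two-disc cover of `Q` by ambient discs.** Two smooth maps `F_A, F_B : ℝⁿ⁺¹ → Q`, each
injective with injective differential on the closed unit ball `𝔻ⁿ⁺¹`, such that the two images
of `𝔻ⁿ⁺¹` cover `Q`, a point common to both images is the image of unit vectors only, and the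
two images of the unit sphere agree. (The discs of a twisted sphere `𝔻ⁿ⁺¹ ∪_φ 𝔻ⁿ⁺¹`,
Kervaire–Milnor 1963 §1, presented by maps of the ambient space, as they arise from charts and
caps.) [cite: KervaireMilnor1963, §1] -/
structure SmoothTwoDiscCover (n : ℕ) (Q : Type*) [TopologicalSpace Q] [ChartedSpace (𝔼 (n + 1)) Q] where
  /-- The first ambient disc. -/
  FA : 𝔼 (n + 1) → Q
  /-- The second ambient disc. -/
  FB : 𝔼 (n + 1) → Q
  /-- The first map is smooth. -/
  contMDiff_FA : ContMDiff (𝓡 (n + 1)) (𝓡 (n + 1)) ∞ FA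
  /-- The second map is smooth. -/
  contMDiff_FB : ContMDiff (𝓡 (n + 1)) (𝓡 (n + 1)) ∞ FB
  /-- The first map is injective on the closed unit ball. -/
  injOn_FA : InjOn FA (closedBall 0 1)
  /-- The second map is injective on the closed unit ball. -/
  injOn_FB : InjOn FB (closedBall 0 1)
  /-- The first map has injective differential on the closed unit ball. -/
  injective_mfderiv_FA : ∀ y ∈ closedBall (0 : 𝔼 (n + 1)) 1,
    Injective (mfderiv (𝓡 (n + 1)) (𝓡 (n + 1)) FA y)
  /-- The second map has injective differential on the closed unit ball. -/
  injective_mfderiv_FB : ∀ y ∈ closedBall (0 : 𝔼 (n + 1)) 1,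
    Injective (mfderiv (𝓡 (n + 1)) (𝓡 (n + 1)) FB y)
  /-- The two discs cover `Q`. -/
  union_eq : FA '' closedBall 0 1 ∪ FB '' closedBall 0 1 = univ
  /-- The two discs meet only in images of unit vectors. -/
  norm_eq_one_of_eq : ∀ a ∈ closedBall (0 : 𝔼 (n + 1)) 1, ∀ b ∈ closedBall (0 : 𝔼 (n + 1)) 1,
    FA a = FB b → ‖a‖ = 1 ∧ ‖b‖ = 1
  /-- The two boundary spheres agree. -/
  image_sphere_eq : FA '' sphere 0 1 = FB '' sphere 0 1

namespace SmoothTwoDiscCover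

variable {n : ℕ} {Q : Type*} [TopologicalSpace Q] [ChartedSpace (𝔼 (n + 1)) Q]
  (T : SmoothTwoDiscCover n Q)

/-- Exchanging the two discs gives a two-disc cover. [folklore] -/
def swap : SmoothTwoDiscCover n Q where
  FA := T.FB
  FB := T.FA
  contMDiff_FA := T.contMDiff_FB
  contMDiff_FB := T.contMDiff_FA
  injOn_FA := T.injOn_FB
  injOn_FB := T.injOn_FA
  injective_mfderiv_FA := T.injective_mfderiv_FB
  injective_mfderiv_FB := T.injective_mfderiv_FA
  union_eq := by rw [union_comm]; exact T.union_eq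
  norm_eq_one_of_eq := fun a ha b hb h => (T.norm_eq_one_of_eq b hb a ha h.symm).symm
  image_sphere_eq := T.image_sphere_eq.symm

/-! ### The two embedded discs -/

/-- The first disc `F_A|𝔻ⁿ⁺¹`. [folklore] -/
def jA : (𝔻 (n + 1)) → Q := T.FA ∘ Subtype.val

/-- The second disc `F_B|𝔻ⁿ⁺¹`. [folklore] -/
def jB : (𝔻 (n + 1)) → Q := T.FB ∘ Subtype.val

/-- Unfolding of the first disc. [folklore] -/
@[simp] theorem jA_apply (a : 𝔻 (n + 1)) : T.jA a = T.FA a := rfl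

/-- Unfolding of the second disc. [folklore] -/
@[simp] theorem jB_apply (b : 𝔻 (n + 1)) : T.jB b = T.FB b := rfl

/-- The first disc is a smooth embedding of the manifold with boundary `𝔻ⁿ⁺¹`
(`isSmoothEmbedding_comp_coe_closedBall_of_injective_mfderiv`). [folklore] -/
theorem isSmoothEmbedding_jA [T2Space Q] [IsManifold (𝓡 (n + 1)) ∞ Q] :
    Manifold.IsSmoothEmbedding (𝓡∂ (n + 1)) (𝓡 (n + 1)) ∞ T.jA :=
  isSmoothEmbedding_comp_coe_closedBall_of_injective_mfderiv T.contMDiff_FA T.injOn_FA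
    T.injective_mfderiv_FA

/-- The second disc is a smooth embedding of `𝔻ⁿ⁺¹`. [folklore] -/
theorem isSmoothEmbedding_jB [T2Space Q] [IsManifold (𝓡 (n + 1)) ∞ Q] :
    Manifold.IsSmoothEmbedding (𝓡∂ (n + 1)) (𝓡 (n + 1)) ∞ T.jB :=
  T.swap.isSmoothEmbedding_jA

/-- The two discs cover `Q`. [folklore] -/
theorem range_jA_union : range T.jA ∪ range T.jB = univ := by
  rw [jA, jB, range_comp, range_comp, Subtype.range_coe]
  exact T.union_eq

/-! ### The transition map of the common boundary sphere -/

/-- Every point of the first boundary sphere is a point of the second one. [folklore] -/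
theorem exists_FB_eq (z : 𝕊 n) : ∃ w : 𝕊 n, T.FB w = T.FA z := by
  have hz : T.FA z ∈ T.FB '' sphere 0 1 := by
    rw [← T.image_sphere_eq]
    exact mem_image_of_mem _ z.2
  obtain ⟨w, hw, hwz⟩ := hz
  exact ⟨⟨w, hw⟩, hwz⟩

/-- **The transition map** `φ z = F_B⁻¹ (F_A z)` of the common boundary sphere, as a function.
[folklore] -/
def transitionFun (z : 𝕊 n) : 𝕊 n := (T.exists_FB_eq z).choose

/-- Defining property of the transition map: `F_B (φ z) = F_A z`. [folklore] -/
theorem FB_transitionFun (z : 𝕊 n) : T.FB (T.transitionFun z) = T.FA z :=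
  (T.exists_FB_eq z).choose_spec

/-- Uniqueness: a point of the closed ball with `F_B w = F_A z` is `φ z`. [folklore] -/
theorem eq_transitionFun {z : 𝕊 n} {w : 𝔼 (n + 1)} (hw : w ∈ closedBall (0 : 𝔼 (n + 1)) 1)
    (h : T.FB w = T.FA z) : w = T.transitionFun z :=
  T.injOn_FB hw (sphere_subset_closedBall (T.transitionFun z).2) (h.trans (T.FB_transitionFun z).symm)

/-- The transition maps of `T` and of the swapped cover are mutually inverse. [folklore] -/
theorem transitionFun_swap_transitionFun (w : 𝕊 n) :
    T.transitionFun (T.swap.transitionFun w) = w := by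
  symm
  apply Subtype.ext
  apply T.eq_transitionFun (sphere_subset_closedBall w.2)
  -- `F_A (φ' w) = F_B w`
  exact (T.swap.FB_transitionFun w).symm

/-- The transition map is continuous: `F_B|𝔻` is a topological embedding and
`F_B ∘ φ = F_A` on the sphere. [folklore] -/
theorem continuous_transitionFun [T2Space Q] [IsManifold (𝓡 (n + 1)) ∞ Q] :
    Continuous T.transitionFun := by
  have hemb : Topology.IsEmbedding T.jB := T.isSmoothEmbedding_jB.isEmbedding
  have hincl : Topology.IsEmbedding (sphereToBall n) := Topology.IsEmbedding.inclusion _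
  rw [hincl.continuous_iff, hemb.continuous_iff]
  have : T.jB ∘ sphereToBall n ∘ T.transitionFun = T.FA ∘ Subtype.val := by
    funext z
    simp only [comp_apply, jB_apply]
    exact T.FB_transitionFun z
  rw [this]
  exact T.contMDiff_FA.continuous.comp continuous_subtype_val

/-- The differential of `F_B` at `y`, as an endomorphism of `ℝⁿ⁺¹` (the tangent spaces of the
model space and of `Q` in its charts are `ℝⁿ⁺¹` by definition). [folklore] -/
def mfderivFB (y : 𝔼 (n + 1)) : (𝔼 (n + 1)) →L[ℝ] 𝔼 (n + 1) :=
  mfderiv (𝓡 (n + 1)) (𝓡 (n + 1)) T.FB y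

/-- Unfolding of `mfderivFB`. [folklore] -/
theorem mfderivFB_eq (y : 𝔼 (n + 1)) :
    T.mfderivFB y = mfderiv (𝓡 (n + 1)) (𝓡 (n + 1)) T.FB y := rfl

/-- On the closed ball the differential of `F_B` is injective. [folklore] -/
theorem injective_mfderivFB {y : 𝔼 (n + 1)} (hy : y ∈ closedBall (0 : 𝔼 (n + 1)) 1) :
    Injective (T.mfderivFB y) :=
  T.injective_mfderiv_FB y hy

/-- The differential of `F_B` at a point of the closed ball, an injective endomorphism of
`ℝⁿ⁺¹`, hence bijective, as a continuous linear equivalence. [folklore] -/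
def mfderivEquiv {y : 𝔼 (n + 1)} (hy : y ∈ closedBall (0 : 𝔼 (n + 1)) 1) :
    (𝔼 (n + 1)) ≃L[ℝ] 𝔼 (n + 1) :=
  (LinearEquiv.ofBijective (T.mfderivFB y).toLinearMap
    ⟨T.injective_mfderivFB hy,
      LinearMap.surjective_of_injective (T.injective_mfderivFB hy)⟩).toContinuousLinearEquiv

/-- The equivalence `mfderivEquiv` is the differential of `F_B`. [folklore] -/
theorem coe_mfderivEquiv {y : 𝔼 (n + 1)} (hy : y ∈ closedBall (0 : 𝔼 (n + 1)) 1) :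
    (T.mfderivEquiv hy).toContinuousLinearMap = mfderiv (𝓡 (n + 1)) (𝓡 (n + 1)) T.FB y := by
  ext v
  rfl

/-- `F_B` is a local diffeomorphism at every point of the closed ball (inverse function theorem
on manifolds, `isLocalDiffeomorphAt_of_mfderiv`). [cite: LeeSmoothManifolds2013, Thm. 4.5] -/
theorem isLocalDiffeomorphAt_FB [IsManifold (𝓡 (n + 1)) ∞ Q] {y : 𝔼 (n + 1)}
    (hy : y ∈ closedBall (0 : 𝔼 (n + 1)) 1) :
    IsLocalDiffeomorphAt (𝓡 (n + 1)) (𝓡 (n + 1)) ∞ T.FB y :=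
  isLocalDiffeomorphAt_of_mfderiv isOpen_univ (mem_univ y) T.contMDiff_FB.contMDiffOn
    (by exact_mod_cast le_top) (T.mfderivEquiv hy) (T.coe_mfderivEquiv hy).symm

/-- **The transition map is smooth** (as a map into `ℝⁿ⁺¹`): near `z₀` it is
`e⁻¹ ∘ F_A` for a local inverse `e⁻¹` of `F_B` at `φ z₀`. [cite: LeeSmoothManifolds2013, Thm. 4.5] -/
theorem contMDiff_coe_transitionFun [T2Space Q] [IsManifold (𝓡 (n + 1)) ∞ Q] :
    ContMDiff (𝓡 n) (𝓡 (n + 1)) ∞ (fun z => ((T.transitionFun z : 𝕊 n) : 𝔼 (n + 1))) := by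
  intro z₀
  set w₀ : 𝕊 n := T.transitionFun z₀
  obtain ⟨e, hw₀, heq⟩ := T.isLocalDiffeomorphAt_FB (sphere_subset_closedBall w₀.2)
  -- near `z₀`, `φ z ∈ e.source`
  have hcont := T.continuous_transitionFun
  have hnhds : ∀ᶠ z in 𝓝 z₀, ((T.transitionFun z : 𝕊 n) : 𝔼 (n + 1)) ∈ e.source :=
    (continuous_subtype_val.comp hcont).continuousAt.preimage_mem_nhds
      (e.open_source.mem_nhds hw₀)
  have hEq : (fun z => ((T.transitionFun z : 𝕊 n) : 𝔼 (n + 1))) =ᶠ[𝓝 z₀]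
      fun z => e.invFun (T.FA z) := by
    filter_upwards [hnhds] with z hz
    have h1 : e (T.transitionFun z : 𝔼 (n + 1)) = T.FA z := by
      rw [← heq hz]
      exact T.FB_transitionFun z
    rw [← h1]
    exact (e.left_inv hz).symm
  refine ContMDiffAt.congr_of_eventuallyEq ?_ hEq
  have hFA : ContMDiffAt (𝓡 n) (𝓡 (n + 1)) ∞ (fun z : 𝕊 n => T.FA z) z₀ :=
    (T.contMDiff_FA.comp contMDiff_coe_sphere).contMDiffAt
  have htarget : T.FA z₀ ∈ e.target := by
    have : e (w₀ : 𝔼 (n + 1)) = T.FA z₀ := by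
      rw [← heq hw₀]
      exact T.FB_transitionFun z₀
    rw [← this]
    exact e.map_source hw₀
  have hinv : ContMDiffAt (𝓡 (n + 1)) (𝓡 (n + 1)) ∞ e.invFun (T.FA z₀) :=
    (e.contMDiffOn_invFun.contMDiffAt (e.open_target.mem_nhds htarget))
  exact hinv.comp z₀ hFA

/-- The transition map is smooth as a self-map of `𝕊ⁿ`. [folklore] -/
theorem contMDiff_transitionFun [T2Space Q] [IsManifold (𝓡 (n + 1)) ∞ Q] :
    ContMDiff (𝓡 n) (𝓡 n) ∞ T.transitionFun := by
  haveI := fact_finrank_euclideanSpace_succ n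
  exact (T.contMDiff_coe_transitionFun).codRestrict_sphere (n := n)
    (fun z => (T.transitionFun z).2)

/-- **The transition diffeomorphism** `φ = F_B⁻¹ ∘ F_A : 𝕊ⁿ ≅ 𝕊ⁿ` of a two-disc cover.
[cite: KervaireMilnor1963, §1] -/
def transition [T2Space Q] [IsManifold (𝓡 (n + 1)) ∞ Q] : (𝕊 n) ≃ₘ⟮𝓡 n, 𝓡 n⟯ (𝕊 n) where
  toFun := T.transitionFun
  invFun := T.swap.transitionFun
  left_inv := T.swap.transitionFun_swap_transitionFun
  right_inv := T.transitionFun_swap_transitionFun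
  contMDiff_toFun := T.contMDiff_transitionFun
  contMDiff_invFun := T.swap.contMDiff_transitionFun

/-- The transition diffeomorphism is the transition map (definitional). [folklore] -/
@[simp] theorem transition_apply [T2Space Q] [IsManifold (𝓡 (n + 1)) ∞ Q] (z : 𝕊 n) :
    T.transition z = T.transitionFun z := rfl

/-! ### The twisted sphere -/

/-- **The two discs meet exactly along `z ∼ φ z`.** [cite: KervaireMilnor1963, §1] -/
theorem jA_eq_jB_iff [T2Space Q] [IsManifold (𝓡 (n + 1)) ∞ Q] (a b : 𝔻 (n + 1)) :
    T.jA a = T.jB b ↔ ∃ z : 𝕊 n, a = sphereToBall n z ∧ b = sphereToBall n (T.transition z) := by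
  constructor
  · intro h
    rw [jA_apply, jB_apply] at h
    obtain ⟨ha, hb⟩ := T.norm_eq_one_of_eq a a.2 b b.2 h
    refine ⟨⟨a, mem_sphere_zero_iff_norm.2 ha⟩, Subtype.ext rfl, Subtype.ext ?_⟩
    rw [coe_sphereToBall, transition_apply]
    exact T.eq_transitionFun b.2 h.symm
  · rintro ⟨z, rfl, rfl⟩
    rw [jA_apply, jB_apply, coe_sphereToBall, coe_sphereToBall, transition_apply,
      FB_transitionFun]

/-- **Gluing data**: the two discs realise `Q` as `𝔻ⁿ⁺¹ ∪_φ 𝔻ⁿ⁺¹`. [cite: KervaireMilnor1963, §1] -/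
def ballGluingData [T2Space Q] [IsManifold (𝓡 (n + 1)) ∞ Q] : BallGluingData n T.transition Q where
  jA := T.jA
  jB := T.jB
  isSmoothEmbedding_jA := T.isSmoothEmbedding_jA
  isSmoothEmbedding_jB := T.isSmoothEmbedding_jB
  range_union := T.range_jA_union
  apply_eq_apply_iff := T.jA_eq_jB_iff

/-- **A manifold with a two-disc cover is a twisted sphere** `Σ(φ) = 𝔻ⁿ⁺¹ ∪_φ 𝔻ⁿ⁺¹`, `φ` the
transition diffeomorphism. [cite: KervaireMilnor1963, §1] -/
theorem isTwistedSphere [T2Space Q] [IsManifold (𝓡 (n + 1)) ∞ Q] :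
    IsTwistedSphere n T.transition Q :=
  T.ballGluingData.isTwistedSphere

include T in
/-- Hence some `φ` presents `Q` as a twisted sphere. [cite: KervaireMilnor1963, §1] -/
theorem exists_isTwistedSphere [T2Space Q] [IsManifold (𝓡 (n + 1)) ∞ Q] :
    ∃ φ : (𝕊 n) ≃ₘ⟮𝓡 n, 𝓡 n⟯ (𝕊 n), IsTwistedSphere n φ Q :=
  ⟨T.transition, T.isTwistedSphere⟩

include T in
/-- A manifold with a two-disc cover is compact. [folklore] -/
theorem compactSpace [T2Space Q] [IsManifold (𝓡 (n + 1)) ∞ Q] : CompactSpace Q :=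
  T.isTwistedSphere.compactSpace

end SmoothTwoDiscCover

/-- **A 4-manifold with a two-disc cover is diffeomorphic to `S⁴`, given Cerf's `Γ₄ = 0`**
(twisted-sphere form `cerf_twistedSphere_four`: every `D⁴ ∪_φ D⁴` is diffeomorphic to `S⁴`;
Cerf 1968, with Kervaire–Milnor 1963 §1). [cite: Cerf1968, main theorem (Γ₄ = 0)] [cite: KervaireMilnor1963, §1] -/
theorem SmoothTwoDiscCover.nonempty_diffeomorph_sphere_four (hC : cerf_twistedSphere_four) {Q : Type}
    [TopologicalSpace Q] [T2Space Q] [SecondCountableTopology Q] [ChartedSpace (𝔼 4) Q]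
    [IsManifold (𝓡 4) ∞ Q] (T : SmoothTwoDiscCover 3 Q) :
    Nonempty (Q ≃ₘ⟮𝓡 4, 𝓡 4⟯ (𝕊 4)) := by
  haveI : CompactSpace Q := T.compactSpace
  exact hC T.transition ⟨Q, T.isTwistedSphere⟩

/-- The same from Cerf's theorem in extension form (`cerf_diffeomorph_sphere_three_extends_ball`,
via `cerf_twistedSphere_four_of_extends''`). [cite: Cerf1968, Ch. I §1, Théorème 1 with Corollaire 1 (Γ₄ = 0)] -/
theorem SmoothTwoDiscCover.nonempty_diffeomorph_sphere_four' (hC : cerf_diffeomorph_sphere_three_extends_ball)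
    {Q : Type} [TopologicalSpace Q] [T2Space Q] [SecondCountableTopology Q] [ChartedSpace (𝔼 4) Q]
    [IsManifold (𝓡 4) ∞ Q] (T : SmoothTwoDiscCover 3 Q) :
    Nonempty (Q ≃ₘ⟮𝓡 4, 𝓡 4⟯ (𝕊 4)) :=
  T.nonempty_diffeomorph_sphere_four (cerf_twistedSphere_four_of_extends'' hC)

end Literature.Topology.FourManifolds

end
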